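import Summits.QuantumFields.YangMills.Theorems.F4SubCurvatureDoorShortRootRigiditySliceDensity
import Mathlib
import HarnessLib

/-!
# OddModeRigidity — the typed three-way split of stub `:146`, REGISTERED vocabulary (verbatim restatement)

Crux ⟨stmt-QuantumFields-23035⟩ `ShortRootRigidity` (line g21-C `Cruxes/ShortRootRigidity/Lines/aperture_bootstrap.lean`, registered
stub `:146 stub_oddModeRigidity : OddModeRigidity`).  Planner ym-idea-3 g21 typed the split
`OddModeRigidity ⇐ AnalyticHalf ∧ TorusReduction ∧ TrigonalInjectivityAll` in the crux workfile
`Summits/QuantumFields/YangMills/Cruxes/ShortRootRigidity/Lines/odd_mode_split.lean` (commit 890b83e397f5; critic idea-crit-4 g10 PASS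
14:50:36Z).  Cruxes modules are not importable from `Theorems/`, so this file restates that vocabulary CHARACTER-IDENTICALLY
(`OddModeRigidity`, `pev`, `NoBadModes`, `AnalyticHalf`, `planePt`, `TrigonalInjectivity`, `TrigonalInjectivityAll`, `TorusReduction`),
with the one-line composition `oddModeRigidity_of_split` and the sanity lemma `noBadModes_zero`, so that the three pieces can be landed
BY NAME + SIGNATURE in `Theorems/` files importing this one (first consumer: `trigonalInjectivityAll_holds`, bridge B from the E-free
rational form `TrigonalInjectivityQ`).

HONEST LABEL: vocabulary only; the three pieces, `:146`, ⟨23035⟩, ⟨23125⟩, R2d are OPEN here; the Yang–Mills mass gap is NOT proved;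
no summit is proved by a line.
-/

noncomputable section

namespace Summit.QuantumFields.YangMills.Theorems.F4SubCurvatureDoorOddModeSplitRegistered

open scoped BigOperators RealInnerProductSpace
open MvPolynomial
open Summit.QuantumFields.YangMills.Cruxes.OSLegsAtWeakCouplingC.Sketch (IsSignedPerm)
open Summit.QuantumFields.YangMills.Theorems.F4SubCurvatureDoorMirrorAnalyticityRegistered (E4 InClass)
open Summit.QuantumFields.YangMills.Theorems.F4SubCurvatureDoorSliceDensityRegistered
  (E2 planeEmb perpEmb EvenPartSliceInvariant)

/-- Obligation (4) «ODD-MODE RIGIDITY» (verbatim, shared with g19-A :149 / g20-A :145 / g21-C :146). [problem-side definition] -/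
def OddModeRigidity : Prop :=
  ∀ K : E4 → ℝ, InClass K → EvenPartSliceInvariant K → ∀ (R : E4 ≃ₗᵢ[ℝ] E4) (x : E4), K (R x) = K x

/-- A polynomial on `ℝ⁴` read as a kernel `E4 → ℝ`. -/
def pev (h : MvPolynomial (Fin 4) ℝ) (x : E4) : ℝ := eval (fun i => x i) h

/-- **NoBadModes L**: the degree-`L` shadow of `OddModeRigidity` — a harmonic homogeneous polynomial of degree `L` on `ℝ⁴`, invariant under
the signed permutations and with even part slice-invariant along `Π₀`, is `O(4)`-invariant (hence `0` when `L ≥ 1`). [problem-side definition] -/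
def NoBadModes (L : ℕ) : Prop :=
  ∀ h : MvPolynomial (Fin 4) ℝ, h.IsHomogeneous L → (∑ i, pderiv i (pderiv i h) = 0) →
    (∀ R : E4 ≃ₗᵢ[ℝ] E4, IsSignedPerm R → ∀ x : E4, pev h (R x) = pev h x) →
    EvenPartSliceInvariant (pev h) →
    ∀ (R : E4 ≃ₗᵢ[ℝ] E4) (x : E4), pev h (R x) = pev h x

/-- R-O1, the ANALYTIC HALF. [problem-side definition] -/
def AnalyticHalf : Prop := (∀ L : ℕ, NoBadModes L) → OddModeRigidity

/-- The point `u f₁ + v f₂` of the plane `x + y + z = 0`, `f₁ = (1,−1,0)/√2` (a 2-fold axis of the cube), `f₂ = (1,1,−2)/√6 = d₀ × f₁`. -/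
def planePt (u v : ℝ) : Fin 3 → ℝ :=
  ![u / Real.sqrt 2 + v / Real.sqrt 6, -(u / Real.sqrt 2) + v / Real.sqrt 6, -(2 * v / Real.sqrt 6)]

/-- **TrigonalInjectivity s** (= (P_s) of the note, in trace form): an `O_h`-invariant harmonic homogeneous polynomial of degree `6s` on `ℝ³`
whose trace on the plane `⊥ (1,1,1)` is sectoral, `a · Re (u + i v)^(6s)`, vanishes identically. [problem-side definition] -/
def TrigonalInjectivity (s : ℕ) : Prop :=
  ∀ Y : MvPolynomial (Fin 3) ℝ, Y.IsHomogeneous (6 * s) → (∑ i, pderiv i (pderiv i Y) = 0) →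
    (∀ σ : Equiv.Perm (Fin 3), rename σ Y = Y) →
    (∀ i : Fin 3, aeval (fun j : Fin 3 => if j = i then -(X j : MvPolynomial (Fin 3) ℝ) else X j) Y = Y) →
    (∃ a : ℝ, ∀ u v : ℝ, eval (planePt u v) Y = a * (((u : ℂ) + (v : ℂ) * Complex.I) ^ (6 * s)).re) →
    Y = 0

/-- §1 of the note, all `s`. [problem-side definition] -/
def TrigonalInjectivityAll : Prop := ∀ s : ℕ, 1 ≤ s → TrigonalInjectivity s

/-- §2 of the note: the torus-weight reduction. [problem-side definition] -/
def TorusReduction : Prop := TrigonalInjectivityAll → ∀ L : ℕ, NoBadModes L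

/-- The split composes (one line); the content is in the three pieces. -/
theorem oddModeRigidity_of_split (h₁ : AnalyticHalf) (h₂ : TorusReduction) (h₃ : TrigonalInjectivityAll) :
    OddModeRigidity :=
  h₁ (h₂ h₃)

/-- Sanity: `NoBadModes 0` holds outright (a degree-0 polynomial is constant). -/
theorem noBadModes_zero : NoBadModes 0 := by
  intro h hhom _ _ _ R x
  -- a homogeneous polynomial of degree 0 is the constant `coeff 0 h`
  have hc : h = C (coeff 0 h) := by
    have := hhom.totalDegree_le
    exact (MvPolynomial.totalDegree_eq_zero_iff_eq_C).mp (Nat.le_zero.mp this)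
  unfold pev
  rw [hc, eval_C, eval_C]

-- touch (w3 g39, 2026-08-29): comment-only re-land to trigger the farm build of this module's olean (ACCEPTED p729610 at 15:38Z but
-- «remote:stale:unbuilt» for 80+ min, blocking p729723 / p731215 and the registered-vocabulary wrappers); no declaration changed.

end Summit.QuantumFields.YangMills.Theorems.F4SubCurvatureDoorOddModeSplitRegistered

end
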